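import Summits.CriticalPhenomena.PercolationContinuityZ3.Theorems.PercNearOneGluingNoHeavyLowerTailAPLVwThreeLoadClub
import Summits.CriticalPhenomena.PercolationContinuityZ3.Theorems.PercNearOneGluingNoHeavyLowerTailAPLGeometricAll
import Summits.CriticalPhenomena.PercolationContinuityZ3.Theorems.PercNearOneGluingNoHeavyLowerTailAPLTreeFourPointEdge
import HarnessLib

/-!
# `NoHeavyLowerTail` (stmt-CriticalPhenomena-4575) — (V_w) `W ≤ 2|Cov(L,R)|` for THREE loaded vertices, for bond percolation
# on every finite weighted graph

Support file (prover prim-ineq-gen-8 gen 52; `--supports stmt-CriticalPhenomena-4575`; memo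
run/shared/lean/prim/prim-ineq-gen-8/FINDING-gen51-TWOLOAD.md §6c–§6g, FINDING-gen52-THREELOAD-LEAN.md).  No definitions,
no named facts, no sorries.

SETTING (as in `…APLVwTwoLoad.lean`).  `μ = prodBernoulli w` on the pairs of a finite vertex type (arbitrary edge weights),
apex `s`, `K = C(s)`, loads `x, y, z ≥ 0` at `a, b, c`; `p_v = μ(s↔v)`, `τ_uv = μ(s↔u ∩ s↔v)`, `κ_uv = τ_uv − p_up_v`,
`m_uv = μ(u↔v ∩ (s↔u)ᶜ)` (`u, v` joined off `K`), `χ_u = μ(s↔u ∩ v↔w ∩ (s↔v)ᶜ)`.  Elementary bookkeeping (memo §6c) gives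
EXACTLY `W = Σ_u ℓ_u(ℓ_up_u(1−p_u) + Σ_{v≠u}ℓ_vκ_uv)²/p_u` and
`2|Cov(L,R)| = 2Σ_uℓ_u³p_u(1−p_u) + 2Σ_{u≠v}ℓ_uℓ_v²κ_uv + 4Σ_{u<v}m_uvℓ_uℓ_v(ℓ_up_u+ℓ_vp_v) + 4xyz·Σ_u(p_um_vw − χ_u)`
for `L = x1[a∈K] + y1[b∈K] + z1[c∈K]`, `R = Σ_{clusters C ≠ K} ℓ(C)²`.
THIS FILE assembles [this work]:
* `threeLoad_chi_le` — the χ-lemma `μ(s↔a, b↔c, s↮b) ≤ μ(s↔a)μ(b↔c, s↮b)` (`APL.cross_row` with `S = {s}`: BHK + Harris);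
* `threeLoad_aplG_pτm` — APL-G (`APL.aplG_all w s a b`) in `(p, τ, m)` coordinates; `threeLoad_At_spec`;
* `threeLoad_club_pair` — the per-pair hypothesis (♣) of `threeLoad_vw_of_pairs` for the percolation quantities
  (Harris + APL-G + `threeLoad_club_of_aplG`);
* `threeLoad_cs3`, **`threeLoad_v`** — the consequence (V) `Var(L)² ≤ 2E[L]|Cov(L,R)|` for three loads (Cauchy–Schwarz);
* **`threeLoad_vw`** — `W ≤ 2|Cov(L,R)|` for every load supported on three vertices with `0 < μ(s↔v) < 1`, on EVERY finite
  weighted graph.  Inputs: Harris, BHK (χ-lemma), APL-G (gen 38), real algebra (`threeLoad_vw_of_pairs`, gen 51).  Together with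
  `twoLoad_vw` (two loads; Harris alone) this proves the lineage's conjectures (V_w) ⟹ (V) `Var(L)² ≤ 2E[L]|Cov(L,R)|` ⟹ (with
  the proved (P)) (Q0) and `E3(θ) ≤ 0` for all loads on at most three vertices; four loads need inequalities outside the proved
  catalogue (memo §6b).
-/

noncomputable section

namespace Summit.CriticalPhenomena.PercolationContinuityZ3.Theorems

namespace APL

open MeasureTheory Set Literature.Probability.Percolation Literature.Probability.LatticeModels
open scoped Classical

/-- Weighted Cauchy–Schwarz for three terms: `(Σ ℓ_uN_u)² ≤ (Σ ℓ_up_u)(Σ ℓ_uN_u²/p_u)` (`p_u > 0`, `ℓ_u ≥ 0`); the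
difference is `Σ_{u<v} ℓ_up_uℓ_vp_v(N_u/p_u − N_v/p_v)²`.  This is the step (V_w) ⟹ (V). [folklore] -/
theorem threeLoad_cs3 (pa pb pc Na Nb Nc x y z : ℝ) (ha : 0 < pa) (hb : 0 < pb) (hc : 0 < pc)
    (hx : 0 ≤ x) (hy : 0 ≤ y) (hz : 0 ≤ z) :
    (x * Na + y * Nb + z * Nc) ^ 2 ≤ (x * pa + y * pb + z * pc) * (x * Na ^ 2 / pa + y * Nb ^ 2 / pb + z * Nc ^ 2 / pc) := by
  set A := Na / pa with hA
  set B := Nb / pb with hB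
  set C := Nc / pc with hC
  have eA : Na = pa * A := by rw [hA]; field_simp
  have eB : Nb = pb * B := by rw [hB]; field_simp
  have eC : Nc = pc * C := by rw [hC]; field_simp
  clear_value A B C
  subst eA eB eC
  have e1 : x * (pa * A) ^ 2 / pa = x * pa * A ^ 2 := by field_simp
  have e2 : y * (pb * B) ^ 2 / pb = y * pb * B ^ 2 := by field_simp
  have e3 : z * (pc * C) ^ 2 / pc = z * pc * C ^ 2 := by field_simp
  rw [e1, e2, e3]
  have key : (x * pa + y * pb + z * pc) * (x * pa * A ^ 2 + y * pb * B ^ 2 + z * pc * C ^ 2)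
      - (x * (pa * A) + y * (pb * B) + z * (pc * C)) ^ 2
      = (x * pa) * (y * pb) * (A - B) ^ 2 + (x * pa) * (z * pc) * (A - C) ^ 2 + (y * pb) * (z * pc) * (B - C) ^ 2 := by
    ring
  have hnn : 0 ≤ (x * pa) * (y * pb) * (A - B) ^ 2 + (x * pa) * (z * pc) * (A - C) ^ 2
      + (y * pb) * (z * pc) * (B - C) ^ 2 := by positivity
  linarith

variable {V : Type*} [Fintype V] (w : Sym2 V → unitInterval) (s a b c : V)

/-- **The χ-lemma** `μ(s↔a, b↔c, s↮b) ≤ μ(s↔a)·μ(b↔c, s↮b)`, i.e. `Cov(1[a∈K], 1[b↔c off K]) ≤ 0` (`K = C(s)`):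
the instance `S = {s}` of `APL.cross_row` (van den Berg–Häggström–Kahn + Harris). [this work] -/
theorem threeLoad_chi_le :
    (prodBernoulli w).real ((openConn s a : Set (BondConfig V)) ∩ (openConn b c : Set (BondConfig V))
        ∩ (openConn s b : Set (BondConfig V))ᶜ) ≤
      (prodBernoulli w).real (openConn s a : Set (BondConfig V)) *
        (prodBernoulli w).real ((openConn b c : Set (BondConfig V)) ∩ (openConn s b : Set (BondConfig V))ᶜ) := by
  have h := cross_row w ({s} : Set V) b a c
  simp only [Set.biUnion_singleton] at h
  exact h

/-- **APL-G at the apex in `(p, τ, m)`-coordinates.**  With `p_a = μ(s↔a)`, `p_b = μ(s↔b)`, `τ = μ(s↔a ∩ s↔b)`,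
`m = μ(a↔b ∩ (s↔a)ᶜ)`:  `((1−p_a−p_b+τ)τ − (p_a+p_b−τ)m)² ≤ (p_a−τ)(p_b−τ)` — this is `APL.aplG_all w s a b`
(`(T·D − e)² ≤ μ(sa|b)μ(sb|a)`) rewritten through the cell identities `μ(sa|b) = p_a − τ`, `μ(sb|a) = p_b − τ`,
`μ(s|ab) = m`, `Σ cells = 1`. [this work] -/
theorem threeLoad_aplG_pτm :
    ((1 - (prodBernoulli w).real (openConn s a : Set (BondConfig V)) - (prodBernoulli w).real (openConn s b : Set (BondConfig V))
          + (prodBernoulli w).real ((openConn s a : Set (BondConfig V)) ∩ (openConn s b : Set (BondConfig V))))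
        * (prodBernoulli w).real ((openConn s a : Set (BondConfig V)) ∩ (openConn s b : Set (BondConfig V)))
      - ((prodBernoulli w).real (openConn s a : Set (BondConfig V)) + (prodBernoulli w).real (openConn s b : Set (BondConfig V))
          - (prodBernoulli w).real ((openConn s a : Set (BondConfig V)) ∩ (openConn s b : Set (BondConfig V))))
        * (prodBernoulli w).real ((openConn a b : Set (BondConfig V)) ∩ (openConn s a : Set (BondConfig V))ᶜ)) ^ 2 ≤
    ((prodBernoulli w).real (openConn s a : Set (BondConfig V))
        - (prodBernoulli w).real ((openConn s a : Set (BondConfig V)) ∩ (openConn s b : Set (BondConfig V)))) *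
      ((prodBernoulli w).real (openConn s b : Set (BondConfig V))
        - (prodBernoulli w).real ((openConn s a : Set (BondConfig V)) ∩ (openConn s b : Set (BondConfig V)))) := by
  have h := aplG_all w s a b
  have hsum := prodBernoulli_cells_sum_eq_one w s a b
  -- cells
  have cab : (prodBernoulli w).real (openConn s a ∩ (openConn s b)ᶜ : Set (BondConfig V))
      = (prodBernoulli w).real (openConn s a : Set (BondConfig V))
        - (prodBernoulli w).real ((openConn s a : Set (BondConfig V)) ∩ (openConn s b : Set (BondConfig V))) := by
    have := ClusterCovTransfer.real_eq_inter_add_inter_compl w (openConn s a : Set (BondConfig V)) (openConn s b : Set (BondConfig V))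
    linarith
  have cba : (prodBernoulli w).real (openConn s b ∩ (openConn s a)ᶜ : Set (BondConfig V))
      = (prodBernoulli w).real (openConn s b : Set (BondConfig V))
        - (prodBernoulli w).real ((openConn s a : Set (BondConfig V)) ∩ (openConn s b : Set (BondConfig V))) := by
    have := ClusterCovTransfer.real_eq_inter_add_inter_compl w (openConn s b : Set (BondConfig V)) (openConn s a : Set (BondConfig V))
    rw [Set.inter_comm (openConn s b : Set (BondConfig V)) (openConn s a : Set (BondConfig V))] at this
    linarith
  have cm : ((openConn s a)ᶜ ∩ (openConn s b)ᶜ ∩ openConn a b : Set (BondConfig V))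
      = ((openConn a b : Set (BondConfig V)) ∩ (openConn s a : Set (BondConfig V))ᶜ) := by
    ext ω
    simp only [Set.mem_inter_iff, Set.mem_compl_iff]
    constructor
    · rintro ⟨⟨hsa, _⟩, hab⟩
      exact ⟨hab, hsa⟩
    · rintro ⟨hab, hsa⟩
      exact ⟨⟨hsa, fun hsb => hsa (SimpleGraph.Reachable.trans hsb (SimpleGraph.Reachable.symm hab))⟩, hab⟩
  rw [cm] at hsum
  rw [cab, cba] at h hsum
  set pa := (prodBernoulli w).real (openConn s a : Set (BondConfig V))
  set pb := (prodBernoulli w).real (openConn s b : Set (BondConfig V))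
  set τ := (prodBernoulli w).real ((openConn s a : Set (BondConfig V)) ∩ (openConn s b : Set (BondConfig V)))
  set m := (prodBernoulli w).real ((openConn a b : Set (BondConfig V)) ∩ (openConn s a : Set (BondConfig V))ᶜ)
  set u0 := (prodBernoulli w).real ((openConn s a)ᶜ ∩ (openConn s b)ᶜ ∩ (openConn a b)ᶜ : Set (BondConfig V))
  have hu0 : u0 = 1 - (pa - τ) - (pb - τ) - m - τ := by linarith
  rw [hu0] at h
  have e : (pa - τ + (pb - τ) + τ) * (1 - (pa - τ) - (pb - τ) - m - τ + (pa - τ) + (pb - τ)) - (pa - τ + (pb - τ))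
      = (1 - pa - pb + τ) * τ - (pa + pb - τ) * m := by ring
  rw [e] at h
  exact h


/-- `Ã := p/√(1−p²)` is positive and satisfies `Ã²(1−p²) = p²` for `0 < p < 1`. [folklore] -/
theorem threeLoad_At_spec (p : ℝ) (hp : 0 < p) (hp1 : p < 1) :
    0 < p / Real.sqrt (1 - p ^ 2) ∧ (p / Real.sqrt (1 - p ^ 2)) ^ 2 * (1 - p ^ 2) = p ^ 2 := by
  have h1 : 0 < 1 - p ^ 2 := by nlinarith
  have hs : 0 < Real.sqrt (1 - p ^ 2) := Real.sqrt_pos.2 h1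
  refine ⟨div_pos hp hs, ?_⟩
  rw [div_pow, Real.sq_sqrt h1.le, div_mul_cancel₀ _ h1.ne']

/-- **Per-pair input of the three-load theorem.**  For `μ = prodBernoulli w`, apex `s`, vertices `a, b` with
`0 < μ(s↔a), μ(s↔b) < 1`: writing `p_a, p_b, τ = μ(s↔a ∩ s↔b)`, `m = μ(a↔b ∩ (s↔a)ᶜ)`, `κ = τ − p_ap_b` and
`Ã_a = p_a/√(1−p_a²)`, the inequality (♣) `(κ² − κp_ap_b − 2p_ap_bm)(Ã_a+Ã_b)² ≤ (p_ap_b)²` holds.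
Inputs: Harris (`prodBernoulli_harris`), monotonicity, APL-G (`APL.aplG_all`), and the real algebra above. [this work] -/
theorem threeLoad_club_pair (hpa : 0 < (prodBernoulli w).real (openConn s a : Set (BondConfig V)))
    (hpa1 : (prodBernoulli w).real (openConn s a : Set (BondConfig V)) < 1)
    (hpb : 0 < (prodBernoulli w).real (openConn s b : Set (BondConfig V)))
    (hpb1 : (prodBernoulli w).real (openConn s b : Set (BondConfig V)) < 1) :
    (((prodBernoulli w).real ((openConn s a : Set (BondConfig V)) ∩ (openConn s b : Set (BondConfig V)))
          - (prodBernoulli w).real (openConn s a : Set (BondConfig V)) * (prodBernoulli w).real (openConn s b : Set (BondConfig V))) ^ 2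
        - ((prodBernoulli w).real ((openConn s a : Set (BondConfig V)) ∩ (openConn s b : Set (BondConfig V)))
          - (prodBernoulli w).real (openConn s a : Set (BondConfig V)) * (prodBernoulli w).real (openConn s b : Set (BondConfig V)))
          * ((prodBernoulli w).real (openConn s a : Set (BondConfig V)) * (prodBernoulli w).real (openConn s b : Set (BondConfig V)))
        - 2 * ((prodBernoulli w).real (openConn s a : Set (BondConfig V)) * (prodBernoulli w).real (openConn s b : Set (BondConfig V)))
          * (prodBernoulli w).real ((openConn a b : Set (BondConfig V)) ∩ (openConn s a : Set (BondConfig V))ᶜ))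
      * ((prodBernoulli w).real (openConn s a : Set (BondConfig V)) / Real.sqrt (1 - (prodBernoulli w).real (openConn s a : Set (BondConfig V)) ^ 2)
        + (prodBernoulli w).real (openConn s b : Set (BondConfig V)) / Real.sqrt (1 - (prodBernoulli w).real (openConn s b : Set (BondConfig V)) ^ 2)) ^ 2
      ≤ ((prodBernoulli w).real (openConn s a : Set (BondConfig V)) * (prodBernoulli w).real (openConn s b : Set (BondConfig V))) ^ 2 := by
  set pa := (prodBernoulli w).real (openConn s a : Set (BondConfig V)) with hpa'
  set pb := (prodBernoulli w).real (openConn s b : Set (BondConfig V)) with hpb'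
  set τ := (prodBernoulli w).real ((openConn s a : Set (BondConfig V)) ∩ (openConn s b : Set (BondConfig V))) with hτ
  set m := (prodBernoulli w).real ((openConn a b : Set (BondConfig V)) ∩ (openConn s a : Set (BondConfig V))ᶜ) with hm
  have hapl := threeLoad_aplG_pτm w s a b
  have hH : pa * pb ≤ τ :=
    prodBernoulli_harris w (isUpperSet_openConn s a) (isUpperSet_openConn s b)
      MeasurableSet.of_discrete MeasurableSet.of_discrete
  have hτa : τ ≤ pa := measureReal_mono Set.inter_subset_left
  have hτb : τ ≤ pb := measureReal_mono Set.inter_subset_right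
  have hm0 : 0 ≤ m := measureReal_nonneg
  obtain ⟨_, hA⟩ := threeLoad_At_spec pa hpa hpa1
  obtain ⟨_, hB⟩ := threeLoad_At_spec pb hpb hpb1
  exact threeLoad_club_of_aplG pa pb τ m _ _ hpa hpa1 hpb hpb1 hH hτa hτb hm0 hapl hA hB

/-- **(V_w) for THREE loaded vertices on every finite weighted graph.**  Let `μ = prodBernoulli w` (bond percolation with
arbitrary edge weights on a finite vertex type), `s` an apex with cluster `K = C(s)`, and `a, b, c` vertices carrying loads
`x, y, z ≥ 0`, with `0 < μ(s↔v) < 1` for `v = a, b, c` (non-degeneracy).  Write `p_v = μ(s↔v)`, `τ_uv = μ(s↔u ∩ s↔v)`,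
`κ_uv = τ_uv − p_up_v = Cov(1[u∈K],1[v∈K])`, `m_uv = μ(u↔v ∩ (s↔u)ᶜ) = P(u↔v off K)`, `χ_u = μ(s↔u ∩ v↔w ∩ (s↔v)ᶜ) =
P(u∈K, v↔w off K)`.  Then (memo FINDING-gen51-TWOLOAD.md §6c: these are EXACTLY `W = Σ_v ℓ_v Cov(1[v∈K], L)²/p_v` and
`2|Cov(L,R)|` for `L = x1[a∈K]+y1[b∈K]+z1[c∈K]`, `R = Σ_{clusters C ≠ K} ℓ(C)²`):
  `Σ_u ℓ_u(ℓ_up_u(1−p_u) + Σ_{v≠u}ℓ_vκ_uv)²/p_u ≤ 2Σ_uℓ_u³p_u(1−p_u) + 2Σ_{u≠v}ℓ_uℓ_v²κ_uv + 4Σ_{u<v}m_uvℓ_uℓ_v(ℓ_up_u+ℓ_vp_v)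
     + 4xyz·Σ_u(p_um_vw − χ_u)`,
i.e. **`W ≤ 2|Cov(L,R)|` for every load supported on three vertices** (hence (V) `Var(L)² ≤ 2E[L]|Cov(L,R)|` by Cauchy–Schwarz,
and with the proved (P), (Q0) and `E3(θ) ≤ 0`; two loads: `twoLoad_vw`, Harris alone).
PROOF INPUTS: Harris; the χ-lemma `threeLoad_chi_le` (BHK); APL-G at the apex (`APL.aplG_all`, gen 38) through
`threeLoad_club_pair`; and the real algebra `threeLoad_vw_of_pairs` (cancellation identity, Cauchy–Schwarz, Hölder pair lemma).
The statement is parametrised by reals equal to the event probabilities (hypotheses `h…`), for readability. [this work] -/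
theorem threeLoad_vw (x y z : ℝ) (hx : 0 ≤ x) (hy : 0 ≤ y) (hz : 0 ≤ z)
    {pa pb pc tab tac tbc mab mac mbc ca cb cc : ℝ}
    (hpa : pa = (prodBernoulli w).real (openConn s a : Set (BondConfig V)))
    (hpb : pb = (prodBernoulli w).real (openConn s b : Set (BondConfig V)))
    (hpc : pc = (prodBernoulli w).real (openConn s c : Set (BondConfig V)))
    (htab : tab = (prodBernoulli w).real ((openConn s a : Set (BondConfig V)) ∩ (openConn s b : Set (BondConfig V))))
    (htac : tac = (prodBernoulli w).real ((openConn s a : Set (BondConfig V)) ∩ (openConn s c : Set (BondConfig V))))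
    (htbc : tbc = (prodBernoulli w).real ((openConn s b : Set (BondConfig V)) ∩ (openConn s c : Set (BondConfig V))))
    (hmab : mab = (prodBernoulli w).real ((openConn a b : Set (BondConfig V)) ∩ (openConn s a : Set (BondConfig V))ᶜ))
    (hmac : mac = (prodBernoulli w).real ((openConn a c : Set (BondConfig V)) ∩ (openConn s a : Set (BondConfig V))ᶜ))
    (hmbc : mbc = (prodBernoulli w).real ((openConn b c : Set (BondConfig V)) ∩ (openConn s b : Set (BondConfig V))ᶜ))
    (hca : ca = (prodBernoulli w).real ((openConn s a : Set (BondConfig V)) ∩ (openConn b c : Set (BondConfig V))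
      ∩ (openConn s b : Set (BondConfig V))ᶜ))
    (hcb : cb = (prodBernoulli w).real ((openConn s b : Set (BondConfig V)) ∩ (openConn a c : Set (BondConfig V))
      ∩ (openConn s a : Set (BondConfig V))ᶜ))
    (hcc : cc = (prodBernoulli w).real ((openConn s c : Set (BondConfig V)) ∩ (openConn a b : Set (BondConfig V))
      ∩ (openConn s a : Set (BondConfig V))ᶜ))
    (h0a : 0 < pa) (h1a : pa < 1) (h0b : 0 < pb) (h1b : pb < 1) (h0c : 0 < pc) (h1c : pc < 1) :
    x * (x * pa * (1 - pa) + y * (tab - pa * pb) + z * (tac - pa * pc)) ^ 2 / pa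
        + y * (y * pb * (1 - pb) + x * (tab - pa * pb) + z * (tbc - pb * pc)) ^ 2 / pb
        + z * (z * pc * (1 - pc) + x * (tac - pa * pc) + y * (tbc - pb * pc)) ^ 2 / pc
      ≤ 2 * (x ^ 3 * pa * (1 - pa) + y ^ 3 * pb * (1 - pb) + z ^ 3 * pc * (1 - pc))
          + 2 * (x * y ^ 2 * (tab - pa * pb) + y * x ^ 2 * (tab - pa * pb) + x * z ^ 2 * (tac - pa * pc)
            + z * x ^ 2 * (tac - pa * pc) + y * z ^ 2 * (tbc - pb * pc) + z * y ^ 2 * (tbc - pb * pc))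
          + 4 * (mab * x * y * (x * pa + y * pb) + mac * x * z * (x * pa + z * pc) + mbc * y * z * (y * pb + z * pc))
          + 4 * x * y * z * ((pa * mbc - ca) + (pb * mac - cb) + (pc * mab - cc)) := by
  -- the three χ-lemmas
  have hχa : ca ≤ pa * mbc := by rw [hca, hpa, hmbc]; exact threeLoad_chi_le w s a b c
  have hχb : cb ≤ pb * mac := by rw [hcb, hpb, hmac]; exact threeLoad_chi_le w s b a c
  have hχc : cc ≤ pc * mab := by rw [hcc, hpc, hmab]; exact threeLoad_chi_le w s c a b
  -- the three (♣)'s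
  obtain ⟨hAa, hAa2⟩ := threeLoad_At_spec pa h0a h1a
  obtain ⟨hAb, hAb2⟩ := threeLoad_At_spec pb h0b h1b
  obtain ⟨hAc, hAc2⟩ := threeLoad_At_spec pc h0c h1c
  have cab := threeLoad_club_pair w s a b (by rw [← hpa]; exact h0a) (by rw [← hpa]; exact h1a)
    (by rw [← hpb]; exact h0b) (by rw [← hpb]; exact h1b)
  have cac := threeLoad_club_pair w s a c (by rw [← hpa]; exact h0a) (by rw [← hpa]; exact h1a)
    (by rw [← hpc]; exact h0c) (by rw [← hpc]; exact h1c)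
  have cbc := threeLoad_club_pair w s b c (by rw [← hpb]; exact h0b) (by rw [← hpb]; exact h1b)
    (by rw [← hpc]; exact h0c) (by rw [← hpc]; exact h1c)
  rw [← hpa, ← hpb, ← htab, ← hmab] at cab
  rw [← hpa, ← hpc, ← htac, ← hmac] at cac
  rw [← hpb, ← hpc, ← htbc, ← hmbc] at cbc
  exact threeLoad_vw_of_pairs pa pb pc (tab - pa * pb) (tac - pa * pc) (tbc - pb * pc) mab mac mbc ca cb cc x y z
    _ _ _ h0a h0b h0c hx hy hz hAa hAb hAc hAa2 hAb2 hAc2 hχa hχb hχc cab cac cbc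

/-- **(V) for three loaded vertices on every finite weighted graph**: in the setting of `threeLoad_vw`,
`Var(L)² ≤ 2·E[L]·|Cov(L,R)|`, written out: `(Σ_u ℓ_uN_u)² ≤ (Σ_u ℓ_up_u)·(2|Cov(L,R)| expanded)` with
`N_u = ℓ_up_u(1−p_u) + Σ_{v≠u}ℓ_vκ_uv = Cov(1[u∈K], L)` (so `Σ_uℓ_uN_u = Var L`, `Σ_uℓ_up_u = E L`).
From `threeLoad_vw` and Cauchy–Schwarz (`threeLoad_cs3`). [this work] -/
theorem threeLoad_v (x y z : ℝ) (hx : 0 ≤ x) (hy : 0 ≤ y) (hz : 0 ≤ z)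
    {pa pb pc tab tac tbc mab mac mbc ca cb cc : ℝ}
    (hpa : pa = (prodBernoulli w).real (openConn s a : Set (BondConfig V)))
    (hpb : pb = (prodBernoulli w).real (openConn s b : Set (BondConfig V)))
    (hpc : pc = (prodBernoulli w).real (openConn s c : Set (BondConfig V)))
    (htab : tab = (prodBernoulli w).real ((openConn s a : Set (BondConfig V)) ∩ (openConn s b : Set (BondConfig V))))
    (htac : tac = (prodBernoulli w).real ((openConn s a : Set (BondConfig V)) ∩ (openConn s c : Set (BondConfig V))))
    (htbc : tbc = (prodBernoulli w).real ((openConn s b : Set (BondConfig V)) ∩ (openConn s c : Set (BondConfig V))))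
    (hmab : mab = (prodBernoulli w).real ((openConn a b : Set (BondConfig V)) ∩ (openConn s a : Set (BondConfig V))ᶜ))
    (hmac : mac = (prodBernoulli w).real ((openConn a c : Set (BondConfig V)) ∩ (openConn s a : Set (BondConfig V))ᶜ))
    (hmbc : mbc = (prodBernoulli w).real ((openConn b c : Set (BondConfig V)) ∩ (openConn s b : Set (BondConfig V))ᶜ))
    (hca : ca = (prodBernoulli w).real ((openConn s a : Set (BondConfig V)) ∩ (openConn b c : Set (BondConfig V))
      ∩ (openConn s b : Set (BondConfig V))ᶜ))
    (hcb : cb = (prodBernoulli w).real ((openConn s b : Set (BondConfig V)) ∩ (openConn a c : Set (BondConfig V))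
      ∩ (openConn s a : Set (BondConfig V))ᶜ))
    (hcc : cc = (prodBernoulli w).real ((openConn s c : Set (BondConfig V)) ∩ (openConn a b : Set (BondConfig V))
      ∩ (openConn s a : Set (BondConfig V))ᶜ))
    (h0a : 0 < pa) (h1a : pa < 1) (h0b : 0 < pb) (h1b : pb < 1) (h0c : 0 < pc) (h1c : pc < 1) :
    (x * (x * pa * (1 - pa) + y * (tab - pa * pb) + z * (tac - pa * pc))
        + y * (y * pb * (1 - pb) + x * (tab - pa * pb) + z * (tbc - pb * pc))
        + z * (z * pc * (1 - pc) + x * (tac - pa * pc) + y * (tbc - pb * pc))) ^ 2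
      ≤ (x * pa + y * pb + z * pc) *
        (2 * (x ^ 3 * pa * (1 - pa) + y ^ 3 * pb * (1 - pb) + z ^ 3 * pc * (1 - pc))
          + 2 * (x * y ^ 2 * (tab - pa * pb) + y * x ^ 2 * (tab - pa * pb) + x * z ^ 2 * (tac - pa * pc)
            + z * x ^ 2 * (tac - pa * pc) + y * z ^ 2 * (tbc - pb * pc) + z * y ^ 2 * (tbc - pb * pc))
          + 4 * (mab * x * y * (x * pa + y * pb) + mac * x * z * (x * pa + z * pc) + mbc * y * z * (y * pb + z * pc))
          + 4 * x * y * z * ((pa * mbc - ca) + (pb * mac - cb) + (pc * mab - cc))) := by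
  have hW := threeLoad_vw w s a b c x y z hx hy hz hpa hpb hpc htab htac htbc hmab hmac hmbc hca hcb hcc
    h0a h1a h0b h1b h0c h1c
  have hcs := threeLoad_cs3 pa pb pc (x * pa * (1 - pa) + y * (tab - pa * pb) + z * (tac - pa * pc))
    (y * pb * (1 - pb) + x * (tab - pa * pb) + z * (tbc - pb * pc))
    (z * pc * (1 - pc) + x * (tac - pa * pc) + y * (tbc - pb * pc)) x y z h0a h0b h0c hx hy hz
  have hE : 0 ≤ x * pa + y * pb + z * pc := by positivity
  exact hcs.trans (mul_le_mul_of_nonneg_left hW hE)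

end APL

end Summit.CriticalPhenomena.PercolationContinuityZ3.Theorems
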